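import Summits.NavierStokesRegularity.FluidComputer.GateBudgetAfterglow
import HarnessLib

/-!
# What no tuning can beat, part 10: THE PULSE FLIPS THE CLOCK — the radius law, the peak law,
# the reversal law, the no-return law and the residence laws of the trigger pulse

Cell `pub-fluidc`, blueprint seat bp1 (gen 26); same namespace and conventions as parts 1–9
(`GateBudget*.lean`); this part imports part 5 (`GateBudgetAfterglow`); its knob forms (§29) are
part 11 (`GateBudgetPulseKnob`). HONEST FRAMING (verbatim): low prior, high
value-of-information experiment on Tao's machine paradigm; NOT a claim that NS blows up. Five-mode
quadratic ODEs on `ℝ⁵` (`fiveGateCircuit ε σ μ R K`: CLOCK pump `ε : a → b`, SEED pump `σ : a → c`,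
TRIGGER amplifier `μ : b ⇒ c`, rotor `R : c ∘ (a,d)`, DRAIN pump `K : d → ã`; gen 22's knob family
`rotorCircuit K M ε ρ` is the slice `σ = ρ²e^{-M}, μ = ε⁻¹M, R = ρ⁻²`, Tao's (5.5) is `ρ = ε`,
`M = K¹⁰`) started EXACTLY at (5.6) `delayInit`; nothing is proved about the Navier–Stokes
equations.

## Why this part exists

Part 5 (`GateBudgetAfterglow`) typed what a DEAD clock (`b ≤ -β`) does to the gate (pulse decay,
carrier freeze, afterglow) but, as its HONEST LIMITS say, contains "no statement that the clock DOES
die". The robust-firing necessity programme (SPEC-INPUT-bp1 §S, item S13″) needs exactly that, with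
a MARGIN `β` of the order of the clock itself, and it needs the time the trigger `c` spends above a
level (the over-turning threshold `R·c ≥ λ` of part 9's envelope law) bounded LOGARITHMICALLY in the
pulse height. Both follow from one observation already behind part 6's dose law: the amplifier
`(∂ₜb, ∂ₜc) = μc·(-c, b)` ROTATES the trigger pair and conserves its radius `r² = b² + c²`, so a
pulse that rises out of an armed clock `(b,c) ≈ (r, 0⁺)` must set with the clock REVERSED,
`(b,c) ≈ (-r, 0⁺)`. Read at the level of derivatives (no integrals, no hitting times; every law
holds for EVERY exact trajectory from (5.6) and ALL signs-admissible couplings; the window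
hypotheses are assumed, as in parts 5–9):

* §22 RADIUS LAW (`radius_lower`): `r(t)² ≥ r(s)² - ε(ε+σ)(t² - s²)` for `0 ≤ s ≤ t` — the pair
  loses radius only through the clock pump acting on a reversed clock (`2εa²b ≥ -2ε|b|`), at most
  `2ε(ε+σ)t` per unit time; on the pulse time-scale the radius is frozen.
* §23 CLOCK FALL, DEATH WITH A MARGIN and TRANSIT (`clock_falls`, `pulse_kills_clock_margin`,
  `clock_transit`): while `c ≥ γ` the clock falls at rate `≥ μγ² - ε`; a pulse `c ≥ γ` on `[T,T+τ]`
  with `(ε+σ)T + ετ + β ≤ μγ²τ` leaves `b(T+τ) ≤ -β`; the clock crosses any band `[-β, β]` in time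
  `≤ 2β/(μγ² - ε)`.
* §24 PEAK LAW (`peak_law`): where the clock vanishes (`|b(t₀)| ≤ β₀`) the trigger carries the whole
  radius: `c(t₀)² ≥ r(s)² - β₀² - ε(ε+σ)(t₀² - s²)` — the pulse peaks at the clock's pre-pulse
  level (the toy's `c_max/ε ≈ t_fire`, data README `pub-fluidc-bp1/data/g23-toy/` (P6)).
* §25 REVERSAL LAW (`clock_reversal`, `clock_flip`): on a window where `c ≥ η` with `μη² ≥ ε`, once
  the clock has touched zero it ends the window at `b(T) ≤ -√(r(s)² - ε(ε+σ)(T²-s²) - c(T)²)`; if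
  the trigger leaves the window no higher than it entered (`c(T) ≤ c(s)`):
  `b(T) ≤ -√(b(s)² - ε(ε+σ)(T² - s²))` — THE PULSE FLIPS THE CLOCK: it exits with its entry value,
  sign reversed (margin `β ≈ r ≈ ε·t_c`, the toy's `b/ε ≈ -1.1 … -1.4` after firing).
* §26 NO-RETURN LAW (`clock_no_return`): while the pair is armed (`r² ≥ ϱ²`) the clock crosses each
  level `L` with `μ(ϱ² - L²) > ε` at most once, downwards (strict barrier: at `b = L` the trigger
  holds `c² ≥ ϱ² - L²`, so `∂ₜb ≤ ε - μ(ϱ² - L²) < 0`; Mathlib's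
  `image_le_of_deriv_right_lt_deriv_boundary'`) — in particular a dead clock STAYS dead for as long
  as the pair is armed (`clock_stays_dead`), with no `β₀/(2ε)` time limit (compare part 5's
  `clock_stays_reversed`).
* §27 RISE LAW and RISE RESIDENCE (`trigger_rise`, `rise_residence`): while the clock is alive at
  level `b ≥ β` the trigger e-folds every `1/(μβ)` (`c(t) ≥ c(s)e^{μβ(t-s)}`), so — the trigger
  being capped by its budget `(ε+σ)t` (part 1) — it cannot sit above a level `ℓ` with the clock
  alive for longer than `log((ε+σ)t/ℓ)/(μβ)`: A LIVE CLOCK IS A FUSE.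
* §28 DECAY RESIDENCE (`decay_residence`): after clock death (`b ≤ -β`) the trigger leaves every
  level `ℓ` above the seed floor `σ/(μβ)` within `log(c(T)/(ℓ - σ/(μβ)))/(μβ)` (part 5's
  `pulse_decay`, read as a residence time).
* §29 (part 11, `GateBudgetPulseKnob`) restates §25, §23, §27, §28 for the knob family
  `rotorCircuit K M ε ρ` in the catalyst variable `u = c/ρ²` of the cell's toys: the residence of
  `u` above a level `λ` is LOGARITHMIC in the pulse height, `≲ (ε/(Mβ))·log(u_max/λ)`.

HONEST LIMITS. Window laws: the hypotheses (`c ≥ η` on the window, a zero of the clock inside it,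
`r² ≥ ϱ²`, `b ≥ β` / `b ≤ -β`) are ASSUMED and are the instantiator's to supply (the radius and
no-return laws are what makes them available on the pulse time-scale `Δt ≪ 1`; over times `~ 1/ε·r`
the radius law is void and part 5's clock-recovery law takes over); nothing here is about the phase
of the carrier, the cascade, or NS. `0` named facts; `0` sorry.
[cite: Tao2016AveragedNS, §5.5 Theorem 5.3, (5.5), (5.6), (b-eq), (energy-con), proof (ob-2),
("comparison argument")].
-/

noncomputable section

namespace Summit.NavierStokesRegularity.FluidComputer.GateBudget

open Real Set Filter Topology
open Literature.Analysis.FluidPDE.Tao2016AveragedNS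
open Literature.Analysis.FluidPDE.Tao2016AveragedNS.Thm53 (antitoneOn_intFactor monotoneOn_intFactor
  antitoneOn_sub_of_deriv_le monotoneOn_sub_of_le_deriv init_a init_b init_c init_d init_e)

variable {ε σ μ R K : ℝ} {X : ℝ → Fin 5 → ℝ}

/-! ## §22 The radius law: the trigger pair keeps its radius on the pulse time-scale -/

/-- Pointwise: with `a² ≤ 1`, `c ≥ 0`, `|b| ≤ B` and `ε, σ ≥ 0`,
`∂ₜ(b² + c²) = 2εa²b + 2σa²c ≥ -2εB` — only the clock pump acting on a reversed clock can shrink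
the trigger pair. [cite: Tao2016AveragedNS, §5.5 proof (ob-2)] -/
theorem radius_deriv_lower {a b c B : ℝ} (ha : a ^ 2 ≤ 1) (hc : 0 ≤ c) (hb : |b| ≤ B)
    (hε : 0 ≤ ε) (hσ : 0 ≤ σ) : -(2 * ε * B) ≤ 2 * ε * a ^ 2 * b + 2 * σ * a ^ 2 * c := by
  have ha0 : 0 ≤ a ^ 2 := sq_nonneg a
  have hB : 0 ≤ B := (abs_nonneg b).trans hb
  have h1 : -B ≤ b := (abs_le.1 hb).1
  have h2 : 0 ≤ a ^ 2 * (b + B) := mul_nonneg ha0 (by linarith)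
  have h3 : 0 ≤ (1 - a ^ 2) * B := mul_nonneg (by linarith) hB
  have h4 : -B ≤ a ^ 2 * b := by nlinarith
  have h5 : 0 ≤ 2 * σ * a ^ 2 * c := by positivity
  nlinarith [mul_le_mul_of_nonneg_left h4 hε]

/-- **THE RADIUS LAW.** For `0 ≤ s ≤ t` (`ε, σ ≥ 0`; every `μ, R, K`):
`b(t)² + c(t)² ≥ b(s)² + c(s)² - ε(ε+σ)(t² - s²)` — the amplifier rotates the trigger pair without
changing its radius, the seed only adds, and the clock pump removes at most `2ε|b| ≤ 2ε(ε+σ)t` per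
unit time (part 1's budget `|b| ≤ (ε+σ)t`). On a pulse window of length `Δ` after time `s` the loss
is `≤ 2ε(ε+σ)(s+Δ)Δ ≪ r² ≈ (εs)²` when `Δ ≪ s`. [cite: Tao2016AveragedNS, §5.5 proof (ob-2)] -/
theorem radius_lower (hX : ∀ t, HasDerivAt X (fiveGateCircuit ε σ μ R K (X t)) t)
    (h0 : X 0 = delayInit) (hε : 0 ≤ ε) (hσ : 0 ≤ σ) {s t : ℝ} (hs : 0 ≤ s) (hst : s ≤ t) :
    X s 1 ^ 2 + X s 2 ^ 2 - ε * (ε + σ) * (t ^ 2 - s ^ 2) ≤ X t 1 ^ 2 + X t 2 ^ 2 := by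
  have hmono := monotoneOn_sub_of_le_deriv (f := fun r => X r 1 ^ 2 + X r 2 ^ 2)
    (f' := fun r => 2 * ε * X r 0 ^ 2 * X r 1 + 2 * σ * X r 0 ^ 2 * X r 2)
    (φ := fun r => -(2 * ε * (ε + σ)) * r) (Φ := fun r => -(2 * ε * (ε + σ)) * r ^ 2 / 2)
    (convex_Ici 0) (fun r _ => bc_energy (hX r)) (fun r _ => hasDerivAt_sq_half _ r)
    (fun r hr => by
      have h := radius_deriv_lower (ε := ε) (σ := σ) (traj_sq_le_one hX h0 r 0)
        (c_nonneg hX h0 hσ hr) (abs_b_le hX h0 hε hσ hr) hε hσ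
      show -(2 * ε * (ε + σ)) * r ≤ 2 * ε * X r 0 ^ 2 * X r 1 + 2 * σ * X r 0 ^ 2 * X r 2
      linarith)
  have h := hmono (mem_Ici.2 hs) (mem_Ici.2 (hs.trans hst)) hst
  dsimp only at h
  linarith

/-! ## §23 The clock falls during the pulse; the transit law -/

/-- **CLOCK FALL.** If `c ≥ γ ≥ 0` on a window `[T₁,T₂]` (`ε, μ ≥ 0`) then for `s ≤ t` in the window
`b(t) ≤ b(s) - (μγ² - ε)(t - s)`: while the trigger is up the clock only falls, at rate `≥ μγ² - ε`
(part 5's `clock_drawn_down`, two-point form). [cite: Tao2016AveragedNS, §5.5 (b-eq)] -/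
theorem clock_falls (hX : ∀ t, HasDerivAt X (fiveGateCircuit ε σ μ R K (X t)) t)
    (h0 : X 0 = delayInit) (hε : 0 ≤ ε) (hμ : 0 ≤ μ) {T₁ T₂ γ : ℝ} (hγ : 0 ≤ γ)
    (hc : ∀ t ∈ Icc T₁ T₂, γ ≤ X t 2) {s t : ℝ} (hs : s ∈ Icc T₁ T₂) (ht : t ∈ Icc T₁ T₂)
    (hst : s ≤ t) : X t 1 ≤ X s 1 - (μ * γ ^ 2 - ε) * (t - s) := by
  have h := clock_drawn_down hX h0 hε hμ (T := s) (τ := t - s) (γ := γ) (by linarith) hγ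
    (fun r hr => hc r ⟨hs.1.trans hr.1, by linarith [hr.2, ht.2]⟩)
  rw [show s + (t - s) = t by ring] at h
  linarith

/-- **CLOCK DEATH WITH A MARGIN.** If `c ≥ γ ≥ 0` on `[T, T+τ]` (`T, τ ≥ 0`; `ε, σ, μ ≥ 0`) and
`(ε+σ)T + ετ + β ≤ μγ²τ`, then `b(T+τ) ≤ -β`: part 5's `pulse_kills_clock` with a signed margin
(`b(T) ≤ (ε+σ)T` by part 1) — the form the afterglow laws consume (item (i) of SPEC §S, S13″b).
[cite: Tao2016AveragedNS, §5.5 (b-eq), proof (ob-2)] -/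
theorem pulse_kills_clock_margin (hX : ∀ t, HasDerivAt X (fiveGateCircuit ε σ μ R K (X t)) t)
    (h0 : X 0 = delayInit) (hε : 0 ≤ ε) (hσ : 0 ≤ σ) (hμ : 0 ≤ μ) {T τ γ β : ℝ} (hT : 0 ≤ T)
    (hτ : 0 ≤ τ) (hγ : 0 ≤ γ) (hc : ∀ t ∈ Icc T (T + τ), γ ≤ X t 2)
    (hβ : (ε + σ) * T + ε * τ + β ≤ μ * γ ^ 2 * τ) : X (T + τ) 1 ≤ -β := by
  have h1 := clock_drawn_down hX h0 hε hμ hτ hγ hc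
  have h2 : X T 1 ≤ (ε + σ) * T := (le_abs_self _).trans (abs_b_le hX h0 hε hσ hT)
  linarith

/-- **CLOCK TRANSIT LAW.** If `c ≥ γ ≥ 0` on `[T₁,T₂]` with `μγ² > ε` (`ε, μ ≥ 0`), and at two times
`s ≤ t` of the window `b(s) ≤ β` and `b(t) ≥ -β`, then `t - s ≤ 2β/(μγ² - ε)`: the clock crosses the
band `[-β, β]` in time at most `2β/(μγ² - ε)` — the DWELL of the pulse at its peak is short.
[cite: Tao2016AveragedNS, §5.5 (b-eq)] -/
theorem clock_transit (hX : ∀ t, HasDerivAt X (fiveGateCircuit ε σ μ R K (X t)) t)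
    (h0 : X 0 = delayInit) (hε : 0 ≤ ε) (hμ : 0 ≤ μ) {T₁ T₂ γ β : ℝ} (hγ : 0 ≤ γ)
    (hγε : ε < μ * γ ^ 2) (hc : ∀ t ∈ Icc T₁ T₂, γ ≤ X t 2) {s t : ℝ} (hs : s ∈ Icc T₁ T₂)
    (ht : t ∈ Icc T₁ T₂) (hst : s ≤ t) (hbs : X s 1 ≤ β) (hbt : -β ≤ X t 1) :
    t - s ≤ 2 * β / (μ * γ ^ 2 - ε) := by
  have h := clock_falls hX h0 hε hμ hγ hc hs ht hst
  rw [le_div_iff₀ (by linarith)]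
  linarith

/-! ## §24 The peak law: the pulse peaks at the clock's pre-pulse level -/

/-- **THE PEAK LAW.** If at a time `t₀ ≥ s ≥ 0` the clock is (nearly) zero, `|b(t₀)| ≤ β₀`, then the
trigger carries the whole radius: `c(t₀)² ≥ b(s)² + c(s)² - β₀² - ε(ε+σ)(t₀² - s²)` (`ε, σ ≥ 0`).
With `s` a pre-pulse time (`c(s) ≈ 0`, `b(s)` the armed clock) this says the pulse PEAKS AT THE
CLOCK'S LEVEL, `c_peak ≥ b(s)·(1 - o(1))`; part 1's `c_le` gives the matching `c_peak ≤ (ε+σ)t₀`.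
[cite: Tao2016AveragedNS, §5.5 proof (ob-2)] -/
theorem peak_law (hX : ∀ t, HasDerivAt X (fiveGateCircuit ε σ μ R K (X t)) t)
    (h0 : X 0 = delayInit) (hε : 0 ≤ ε) (hσ : 0 ≤ σ) {s t₀ β₀ : ℝ} (hs : 0 ≤ s) (hst : s ≤ t₀)
    (hb : |X t₀ 1| ≤ β₀) :
    X s 1 ^ 2 + X s 2 ^ 2 - β₀ ^ 2 - ε * (ε + σ) * (t₀ ^ 2 - s ^ 2) ≤ X t₀ 2 ^ 2 := by
  have h := radius_lower hX h0 hε hσ hs hst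
  have hb2 : X t₀ 1 ^ 2 ≤ β₀ ^ 2 := by
    rw [← sq_abs (X t₀ 1)]
    exact pow_le_pow_left₀ (abs_nonneg _) hb 2
  linarith

/-! ## §25 The reversal law: the pulse flips the clock -/

/-- **THE REVERSAL LAW.** On a window `[s,T] ⊆ [0,∞)` on which the trigger holds `c ≥ η ≥ 0` with
`μη² ≥ ε` (`ε, σ, μ ≥ 0`), if the clock has reached zero somewhere in the window (`b(t₀) ≤ 0`,
`t₀ ∈ [s,T]`), then at the end of the window the clock is reversed, `b(T) ≤ 0`, with
`b(T)² ≥ b(s)² + c(s)² - ε(ε+σ)(T² - s²) - c(T)²`: whatever radius the trigger has given back is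
in the clock again, with the opposite sign (clock fall + radius law).
[cite: Tao2016AveragedNS, §5.5 (b-eq), proof (ob-2)] -/
theorem clock_reversal (hX : ∀ t, HasDerivAt X (fiveGateCircuit ε σ μ R K (X t)) t)
    (h0 : X 0 = delayInit) (hε : 0 ≤ ε) (hσ : 0 ≤ σ) (hμ : 0 ≤ μ) {s T η t₀ : ℝ} (hs : 0 ≤ s)
    (hη : 0 ≤ η) (hηε : ε ≤ μ * η ^ 2) (hc : ∀ t ∈ Icc s T, η ≤ X t 2) (ht₀ : t₀ ∈ Icc s T)
    (hb₀ : X t₀ 1 ≤ 0) :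
    X T 1 ≤ 0 ∧
      X s 1 ^ 2 + X s 2 ^ 2 - ε * (ε + σ) * (T ^ 2 - s ^ 2) - X T 2 ^ 2 ≤ X T 1 ^ 2 := by
  have hsT : s ≤ T := ht₀.1.trans ht₀.2
  have hfall := clock_falls hX h0 hε hμ hη hc ht₀ (right_mem_Icc.2 hsT) ht₀.2
  have hprod : 0 ≤ (μ * η ^ 2 - ε) * (T - t₀) :=
    mul_nonneg (sub_nonneg.2 hηε) (sub_nonneg.2 ht₀.2)
  have hbT : X T 1 ≤ 0 := by linarith
  refine ⟨hbT, ?_⟩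
  have h := radius_lower hX h0 hε hσ hs hsT
  linarith

/-- The reversal law with the square root taken: same hypotheses,
`b(T) ≤ -√(b(s)² + c(s)² - ε(ε+σ)(T² - s²) - c(T)²)`. [cite: Tao2016AveragedNS, §5.5 (b-eq)] -/
theorem clock_reversal_sqrt (hX : ∀ t, HasDerivAt X (fiveGateCircuit ε σ μ R K (X t)) t)
    (h0 : X 0 = delayInit) (hε : 0 ≤ ε) (hσ : 0 ≤ σ) (hμ : 0 ≤ μ) {s T η t₀ : ℝ} (hs : 0 ≤ s)
    (hη : 0 ≤ η) (hηε : ε ≤ μ * η ^ 2) (hc : ∀ t ∈ Icc s T, η ≤ X t 2) (ht₀ : t₀ ∈ Icc s T)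
    (hb₀ : X t₀ 1 ≤ 0) :
    X T 1 ≤ -sqrt (X s 1 ^ 2 + X s 2 ^ 2 - ε * (ε + σ) * (T ^ 2 - s ^ 2) - X T 2 ^ 2) := by
  obtain ⟨hbT, hsq⟩ := clock_reversal hX h0 hε hσ hμ hs hη hηε hc ht₀ hb₀
  have h1 := sqrt_le_sqrt hsq
  rw [sqrt_sq_eq_abs, abs_of_nonpos hbT] at h1
  linarith

/-- **THE PULSE FLIPS THE CLOCK.** Same window; if moreover the trigger leaves the window no higher
than it entered it (`c(T) ≤ c(s)`, e.g. `s` and `T` the entry and exit times of one level `η`), then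
`b(T) ≤ -√(b(s)² - ε(ε+σ)(T² - s²))`: the clock EXITS THE PULSE WITH ITS ENTRY VALUE, SIGN
REVERSED, up to the radius loss `ε(ε+σ)(T²-s²)` (negligible on the pulse time-scale). This is the
clock-death MARGIN the afterglow laws of part 5 ask for: `β ≈ r ≈ ε·t_c` — the toy's
`b/ε = -1.1 … -1.4` after firing (data README `pub-fluidc-bp1/data/g23-toy/` (P6)).
[cite: Tao2016AveragedNS, §5.5 Theorem 5.3, (b-eq), proof (ob-2)] -/
theorem clock_flip (hX : ∀ t, HasDerivAt X (fiveGateCircuit ε σ μ R K (X t)) t)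
    (h0 : X 0 = delayInit) (hε : 0 ≤ ε) (hσ : 0 ≤ σ) (hμ : 0 ≤ μ) {s T η t₀ : ℝ} (hs : 0 ≤ s)
    (hη : 0 ≤ η) (hηε : ε ≤ μ * η ^ 2) (hc : ∀ t ∈ Icc s T, η ≤ X t 2) (hcT : X T 2 ≤ X s 2)
    (ht₀ : t₀ ∈ Icc s T) (hb₀ : X t₀ 1 ≤ 0) :
    X T 1 ≤ -sqrt (X s 1 ^ 2 - ε * (ε + σ) * (T ^ 2 - s ^ 2)) := by
  obtain ⟨hbT, hsq⟩ := clock_reversal hX h0 hε hσ hμ hs hη hηε hc ht₀ hb₀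
  have hsT : s ≤ T := ht₀.1.trans ht₀.2
  have hcT0 : 0 ≤ X T 2 := hη.trans (hc T (right_mem_Icc.2 hsT))
  have hc2 : X T 2 ^ 2 ≤ X s 2 ^ 2 := pow_le_pow_left₀ hcT0 hcT 2
  have hsq' : X s 1 ^ 2 - ε * (ε + σ) * (T ^ 2 - s ^ 2) ≤ X T 1 ^ 2 := by linarith
  have h1 := sqrt_le_sqrt hsq'
  rw [sqrt_sq_eq_abs, abs_of_nonpos hbT] at h1
  linarith

/-! ## §26 The no-return law: an armed clock crosses each level only downwards -/

/-- Pointwise: if the pair is armed, `b² + c² ≥ ϱ²`, and the clock sits at a level `b = L`, then the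
trigger holds `c² ≥ ϱ² - L²` and `∂ₜb = εa² - μc² ≤ ε - μ(ϱ² - L²)` (`a² ≤ 1`, `μ ≥ 0`).
[cite: Tao2016AveragedNS, §5.5 (b-eq)] -/
theorem clock_deriv_at_level {a b c ϱ L : ℝ} (ha : a ^ 2 ≤ 1) (hr : ϱ ^ 2 ≤ b ^ 2 + c ^ 2)
    (hbL : b = L) (hε : 0 ≤ ε) (hμ : 0 ≤ μ) :
    ε * a ^ 2 - μ * c ^ 2 ≤ ε - μ * (ϱ ^ 2 - L ^ 2) := by
  have hc2 : ϱ ^ 2 - L ^ 2 ≤ c ^ 2 := by rw [← hbL]; linarith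
  nlinarith [mul_le_mul_of_nonneg_left ha hε, mul_le_mul_of_nonneg_left hc2 hμ]

/-- **THE NO-RETURN LAW.** On a window `[s,T]` on which the trigger pair stays armed,
`b² + c² ≥ ϱ²`, every level `L` with `μ(ϱ² - L²) > ε` (`ε, μ ≥ 0`) is a one-way barrier for the
clock: `b(s) ≤ L ⇒ b(t) ≤ L` for all `t ∈ [s,T]` (at `b = L` the trigger holds `c² ≥ ϱ² - L²`, so
`∂ₜb ≤ ε - μ(ϱ² - L²) < 0`: a strict barrier, Mathlib's
`image_le_of_deriv_right_lt_deriv_boundary'`). So during the pulse the clock passes each level of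
the band `|L| < √(ϱ² - ε/μ)` EXACTLY ONCE, downwards, and never climbs back while the pair is armed.
[cite: Tao2016AveragedNS, §5.5 (b-eq), proof ("comparison argument")] -/
theorem clock_no_return (hX : ∀ t, HasDerivAt X (fiveGateCircuit ε σ μ R K (X t)) t)
    (h0 : X 0 = delayInit) (hε : 0 ≤ ε) (hμ : 0 ≤ μ) {s T ϱ L : ℝ}
    (harm : ∀ t ∈ Icc s T, ϱ ^ 2 ≤ X t 1 ^ 2 + X t 2 ^ 2) (hL : ε < μ * (ϱ ^ 2 - L ^ 2))
    (hbs : X s 1 ≤ L) {t : ℝ} (ht : t ∈ Icc s T) : X t 1 ≤ L := by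
  have hcont : ContinuousOn (fun r => X r 1) (Icc s T) := (continuous_traj hX 1).continuousOn
  have hder : ∀ r ∈ Ico s T,
      HasDerivWithinAt (fun r => X r 1) (ε * X r 0 ^ 2 - μ * X r 2 ^ 2) (Ici r) r :=
    fun r _ => (hasDerivAt_b hX r).hasDerivWithinAt
  have key := image_le_of_deriv_right_lt_deriv_boundary' hcont hder (B := fun _ => L)
    (B' := fun _ => 0) hbs continuousOn_const (fun r _ => hasDerivWithinAt_const _ _ _)
    (fun r hr hrL => by
      have h := clock_deriv_at_level (ε := ε) (μ := μ) (traj_sq_le_one hX h0 r 0)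
        (harm r (Ico_subset_Icc_self hr)) hrL hε hμ
      show ε * X r 0 ^ 2 - μ * X r 2 ^ 2 < 0
      linarith)
  exact key ht

/-- **A DEAD CLOCK STAYS DEAD WHILE THE PAIR IS ARMED.** If `b(s) ≤ -β` and `b² + c² ≥ ϱ²` on
`[s,T]` with `μ(ϱ² - β²) > ε`, then `b ≤ -β` on all of `[s,T]` — with no time limit of the kind
`β/(2ε)` in part 5's `clock_stays_reversed`: the limit is the arming, not the clock pump.
[cite: Tao2016AveragedNS, §5.5 (b-eq)] -/
theorem clock_stays_dead (hX : ∀ t, HasDerivAt X (fiveGateCircuit ε σ μ R K (X t)) t)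
    (h0 : X 0 = delayInit) (hε : 0 ≤ ε) (hμ : 0 ≤ μ) {s T ϱ β : ℝ}
    (harm : ∀ t ∈ Icc s T, ϱ ^ 2 ≤ X t 1 ^ 2 + X t 2 ^ 2) (hβ : ε < μ * (ϱ ^ 2 - β ^ 2))
    (hbs : X s 1 ≤ -β) {t : ℝ} (ht : t ∈ Icc s T) : X t 1 ≤ -β :=
  clock_no_return hX h0 hε hμ harm (L := -β) (by simpa using hβ) hbs ht

/-- **ARMED WINDOWS FROM THE RADIUS LAW.** If `b(s)² + c(s)² ≥ ϱ² + ε(ε+σ)(T² - s²)` at a time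
`s ≥ 0` then the pair is armed, `b² + c² ≥ ϱ²`, on all of `[s,T]` (`ε, σ ≥ 0`) — the hypothesis of
the no-return law, supplied by §22. [cite: Tao2016AveragedNS, §5.5 proof (ob-2)] -/
theorem armed_window (hX : ∀ t, HasDerivAt X (fiveGateCircuit ε σ μ R K (X t)) t)
    (h0 : X 0 = delayInit) (hε : 0 ≤ ε) (hσ : 0 ≤ σ) {s T ϱ : ℝ} (hs : 0 ≤ s)
    (hϱ : ϱ ^ 2 + ε * (ε + σ) * (T ^ 2 - s ^ 2) ≤ X s 1 ^ 2 + X s 2 ^ 2) {t : ℝ}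
    (ht : t ∈ Icc s T) : ϱ ^ 2 ≤ X t 1 ^ 2 + X t 2 ^ 2 := by
  have h := radius_lower hX h0 hε hσ hs ht.1
  have hts : t ^ 2 - s ^ 2 ≤ T ^ 2 - s ^ 2 := by nlinarith [ht.1, ht.2, hs]
  have hεσ : 0 ≤ ε * (ε + σ) := by positivity
  nlinarith [mul_le_mul_of_nonneg_left hts hεσ]

/-! ## §27 The rise law: a live clock is a fuse -/

/-- **THE RISE LAW.** If the clock holds a level `b ≥ β` (any real `β`) on a window
`[T₁,T₂] ⊆ [0,∞)` (`σ, μ ≥ 0`) then the trigger e-folds every `1/(μβ)`: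
`c(t) ≥ c(s)·e^{μβ(t-s)}` for `s ≤ t` in the window (integrating factor `e^{-μβt}`:
`∂ₜc - μβc = σa² + μ(b - β)c ≥ 0` as `c ≥ 0`).
[cite: Tao2016AveragedNS, §5.5 (5.5), proof ("comparison argument")] -/
theorem trigger_rise (hX : ∀ t, HasDerivAt X (fiveGateCircuit ε σ μ R K (X t)) t)
    (h0 : X 0 = delayInit) (hσ : 0 ≤ σ) (hμ : 0 ≤ μ) {T₁ T₂ β : ℝ} (hT₁ : 0 ≤ T₁)
    (hb : ∀ t ∈ Icc T₁ T₂, β ≤ X t 1) {s t : ℝ} (hs : s ∈ Icc T₁ T₂) (ht : t ∈ Icc T₁ T₂)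
    (hst : s ≤ t) : X s 2 * exp (μ * β * (t - s)) ≤ X t 2 := by
  have hmono := monotoneOn_intFactor (f := fun r => X r 2)
    (f' := fun r => σ * X r 0 ^ 2 + μ * X r 1 * X r 2) (g := fun _ => μ * β)
    (G := fun r => μ * β * r) (φ := fun _ => 0) (Φ := fun _ => 0) (convex_Icc T₁ T₂)
    (fun r _ => hasDerivAt_c hX r)
    (fun r _ => ((hasDerivAt_id' r).const_mul (μ * β)).congr_deriv (by simp))
    (fun r _ => hasDerivAt_const r (0 : ℝ))
    (fun r hr => by
      have hc0 : 0 ≤ X r 2 := c_nonneg hX h0 hσ (hT₁.trans hr.1)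
      have h1 : 0 ≤ μ * X r 2 * (X r 1 - β) :=
        mul_nonneg (mul_nonneg hμ hc0) (by linarith [hb r hr])
      have h2 : 0 ≤ σ * X r 0 ^ 2 := by positivity
      have h3 : 0 ≤ σ * X r 0 ^ 2 + μ * X r 1 * X r 2 - μ * β * X r 2 := by nlinarith
      show (0 : ℝ) ≤ (σ * X r 0 ^ 2 + μ * X r 1 * X r 2 - μ * β * X r 2) * exp (-(μ * β * r))
      exact mul_nonneg h3 (exp_pos _).le)
  have h := hmono hs ht hst
  dsimp only at h
  rw [sub_zero, sub_zero] at h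
  have hE : exp (μ * β * (t - s)) = exp (-(μ * β * s)) * exp (μ * β * t) := by
    rw [← exp_add]; congr 1; ring
  have h2 := mul_le_mul_of_nonneg_right h (exp_pos (μ * β * t)).le
  calc X s 2 * exp (μ * β * (t - s)) = X s 2 * exp (-(μ * β * s)) * exp (μ * β * t) := by
        rw [hE]; ring
    _ ≤ X t 2 * exp (-(μ * β * t)) * exp (μ * β * t) := h2
    _ = X t 2 := by
        rw [mul_assoc, ← exp_add, show -(μ * β * t) + μ * β * t = 0 by ring, exp_zero, mul_one]

/-- **RISE RESIDENCE: A LIVE CLOCK IS A FUSE.** If `b ≥ β > 0` on `[T₁,T₂] ⊆ [0,∞)` (`μ > 0`,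
`ε, σ ≥ 0`) and at a time `s` of the window the trigger has reached `c(s) ≥ ℓ > 0`, then for every
later `t` in the window `t - s ≤ log((ε+σ)t/ℓ)/(μβ)`: the trigger e-folds every `1/(μβ)` (rise law)
but never exceeds its budget `(ε+σ)t` (part 1), so the clock cannot stay alive at level `β` for
longer than `log(budget/ℓ)/(μβ)` once the trigger is macroscopic — it burns out.
[cite: Tao2016AveragedNS, §5.5 (5.5), proof (ob-2)] -/
theorem rise_residence (hX : ∀ t, HasDerivAt X (fiveGateCircuit ε σ μ R K (X t)) t)
    (h0 : X 0 = delayInit) (hε : 0 ≤ ε) (hσ : 0 ≤ σ) (hμ : 0 < μ) {T₁ T₂ β ℓ : ℝ}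
    (hT₁ : 0 ≤ T₁) (hβ : 0 < β) (hb : ∀ t ∈ Icc T₁ T₂, β ≤ X t 1) {s t : ℝ} (hs : s ∈ Icc T₁ T₂)
    (ht : t ∈ Icc T₁ T₂) (hst : s ≤ t) (hℓ : 0 < ℓ) (hcs : ℓ ≤ X s 2) :
    t - s ≤ log ((ε + σ) * t / ℓ) / (μ * β) := by
  have hrise := trigger_rise hX h0 hσ hμ.le hT₁ hb hs ht hst
  have hct : X t 2 ≤ (ε + σ) * t := c_le hX h0 hε hσ (hT₁.trans ht.1)
  have h1 : ℓ * exp (μ * β * (t - s)) ≤ (ε + σ) * t := by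
    have := mul_le_mul_of_nonneg_right hcs (exp_pos (μ * β * (t - s))).le
    linarith
  have h2 : exp (μ * β * (t - s)) ≤ (ε + σ) * t / ℓ := by
    rw [le_div_iff₀ hℓ, mul_comm]; exact h1
  have h3 : μ * β * (t - s) ≤ log ((ε + σ) * t / ℓ) := by
    have := log_le_log (exp_pos _) h2
    rwa [log_exp] at this
  rw [le_div_iff₀ (mul_pos hμ hβ)]
  linarith

/-! ## §28 The decay residence law: after clock death the trigger leaves every level in log time -/

/-- **DECAY RESIDENCE.** If the clock is dead, `b ≤ -β` on `[T,T']` (`β > 0`, `μ > 0`, `σ ≥ 0`,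
`T ≥ 0`), and at a time `t ∈ [T,T']` the trigger still holds `c(t) ≥ ℓ` with `ℓ` above the seed
floor `σ/(μβ)`, then `t - T ≤ log(c(T)/(ℓ - σ/(μβ)))/(μβ)` — part 5's decay law
`c(t) ≤ c(T)e^{-μβ(t-T)} + σ/(μβ)` read as a residence time: the trigger is above `ℓ` for at most
`log(c(T)/(ℓ - floor))` e-folding times `1/(μβ)` after clock death.
[cite: Tao2016AveragedNS, §5.5 (5.5), proof ("comparison argument")] -/
theorem decay_residence (hX : ∀ t, HasDerivAt X (fiveGateCircuit ε σ μ R K (X t)) t)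
    (h0 : X 0 = delayInit) (hσ : 0 ≤ σ) (hμ : 0 < μ) {T T' β ℓ : ℝ} (hT : 0 ≤ T) (hβ : 0 < β)
    (hb : ∀ t ∈ Icc T T', X t 1 ≤ -β) {t : ℝ} (ht : t ∈ Icc T T') (hℓ : σ / (μ * β) < ℓ)
    (hct : ℓ ≤ X t 2) : t - T ≤ log (X T 2 / (ℓ - σ / (μ * β))) / (μ * β) := by
  have hdec := pulse_decay hX h0 hσ hμ hT hβ hb ht
  have hk : 0 < μ * β := mul_pos hμ hβ
  have hℓf : 0 < ℓ - σ / (μ * β) := by linarith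
  have h1 : ℓ - σ / (μ * β) ≤ X T 2 * exp (-(μ * β * (t - T))) := by linarith
  have hE : exp (μ * β * (t - T)) * exp (-(μ * β * (t - T))) = 1 := by
    rw [← exp_add, show μ * β * (t - T) + -(μ * β * (t - T)) = 0 by ring, exp_zero]
  have h2 : exp (μ * β * (t - T)) ≤ X T 2 / (ℓ - σ / (μ * β)) := by
    rw [le_div_iff₀ hℓf]
    have h3 := mul_le_mul_of_nonneg_left h1 (exp_pos (μ * β * (t - T))).le
    calc exp (μ * β * (t - T)) * (ℓ - σ / (μ * β))
        ≤ exp (μ * β * (t - T)) * (X T 2 * exp (-(μ * β * (t - T)))) := h3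
      _ = X T 2 * (exp (μ * β * (t - T)) * exp (-(μ * β * (t - T)))) := by ring
      _ = X T 2 := by rw [hE, mul_one]
  have h4 : μ * β * (t - T) ≤ log (X T 2 / (ℓ - σ / (μ * β))) := by
    have := log_le_log (exp_pos _) h2
    rwa [log_exp] at this
  rw [le_div_iff₀ hk]
  linarith

end Summit.NavierStokesRegularity.FluidComputer.GateBudget
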